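import Summits.Ventures.LatticeQCDFlow.Exactness.IMHCommonRandomNumbersSplit
import Summits.Ventures.LatticeQCDFlow.Exactness.IMHColdStartPathAverage
import HarnessLib

/-!
# Common random numbers contract the disagreement probability: `P(X_n ≠ X′_n) ≤ (1 − A)ⁿ·P(X_0 ≠ X′_0)` for the CRN pair of
# flow-MCMC runs, from every initial coupling

HONEST FRAMING: exact (Metropolis-corrected) sampling algorithms for lattice gauge theory;
figures of merit are autocorrelation/cost numbers at stated couplings and volumes; no
continuum-physics claim.

Venture `LatticeQCDFlow` (cell pub-lqcd), topic `Exactness`; FANOUT row 30 (lean-1, GEN-37).  NEW WORK of the cell,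
general state space with a measurable diagonal (`MeasurableEq Ω` — every Polish configuration space).  GEN-36's
`IMHCommonRandomNumbersSplit` proved `P(X_n ≠ X′_n) ≤ rⁿ` for the common-random-numbers pair chain `K̂` of `K = indepMH q w`
(`w` normalised, maximal at `x₀`, `A = 1/w(x₀)`, `r = 1 − A`) from EVERY initial coupling, through the exact split
`μ̂₀K̂ⁿ = (1 − rⁿ)·π̂ + rⁿ·μ̂₀R̂ⁿ` (`π̂` the diagonal lift of the target, `R̂` the residual pair kernel).  Here the factor
`P(X_0 ≠ X′_0)` is recovered — the pair analogue of this generation's total-variation contraction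
(`IMHTotalVariationContraction`): THE RESIDUAL PAIR KERNEL NEVER SPLITS A MERGED PAIR.

* §1 **`crnPair_diag_offDiagonal`** — `K̂((x,x), Δᶜ) = 0` (runs that have met stay together, GEN-36 `crnPair_diag_apply`);
  **`residual_crnPair_diag_offDiagonal`** — `R̂((x,x), Δᶜ) = 0` too (`R̂ = (K̂ − A·π̂)/(1 − A)` and `π̂(Δᶜ) = 0`);
  **`bind_residual_crnPair_offDiagonal_le`** — hence `(μ̂R̂)(Δᶜ) ≤ μ̂(Δᶜ)` and (**`iterate_bind_residual_crnPair_offDiagonal_le`**)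
  `(μ̂R̂ⁿ)(Δᶜ) ≤ μ̂(Δᶜ)` for every probability law `μ̂` on `Ω × Ω`.
* §2 **`iterate_bind_crnPair_offDiagonal_le`** — THE CONTRACTION: for every initial coupling `μ̂₀` and every `n`,
  `P(X_n ≠ X′_n) ≤ rⁿ·P(X_0 ≠ X′_0)` (all `w(x₀) ≥ 1`); **`iterate_bind_crnPair_diagonal_ge_init`** — `P(X_n = X′_n) ≥
  1 − rⁿ·P(X_0 ≠ X′_0)`; **`integral_iterate_bind_crnPair_abs_sub_le_init`** — observables: `E|g(X_n) − g(X′_n)| ≤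
  rⁿ·P(X_0 ≠ X′_0)·(c − a)` for measurable `a ≤ g ≤ c`; **`crn_chain_integral_abs_sub_le_init`** — the same read on the pair path
  law at time `n`.
Reading (gauge files): two exact gauge samplers fed the same proposals and uniforms that ALREADY agree with probability `1 − p`
disagree after `n` more updates with probability at most `(1 − A)ⁿ·p` — re-coupling after a perturbation (a checkpoint restart,
a one-link edit) costs `log(p/δ)/A` updates, not `log(1/δ)/A`.
NOT CLAIMED: the path-space form «coincide forever after `b` with probability `≥ 1 − r^b·P(X_0 ≠ X′_0)»» (needs the decomposition
of a coupling along the diagonal; not typed here); equality (it holds from `(x₀, x′)`, GEN-36 `IMHCommonRandomNumbersSharp`);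
anything for two different proposals.  No `sorry`, no new definitions, nothing cited as a fact.
-/

noncomputable section

namespace Summit.Ventures.LatticeQCDFlow.Exactness

open MeasureTheory ProbabilityTheory Function Set
open scoped ENNReal unitInterval
open Literature.Probability.MarkovChains
open Summit.Ventures.LatticeQCDFlow.Scoring

variable {Ω : Type*} [MeasurableSpace Ω] {q : Measure Ω} [IsProbabilityMeasure q] {w : Ω → ℝ}

/-! ## §1 The residual pair kernel never splits a merged pair -/

omit [IsProbabilityMeasure q] in
/-- The diagonal lift of any measure gives no mass off the diagonal. [ours, bookkeeping] -/
theorem map_diag_offDiagonal [MeasurableEq Ω] (μ : Measure Ω) :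
    (μ.map (fun y : Ω => (y, y))) (Set.diagonal Ω)ᶜ = 0 := by
  have hdiag : Measurable (fun y : Ω => (y, y)) := measurable_id.prodMk measurable_id
  rw [Measure.map_apply hdiag measurableSet_diagonal.compl]
  have : (fun y : Ω => (y, y)) ⁻¹' (Set.diagonal Ω)ᶜ = ∅ := by
    ext y; simp [Set.mem_diagonal_iff]
  rw [this, measure_empty]

/-- **RUNS THAT HAVE MET STAY TOGETHER**: `K̂((x, x), Δᶜ) = 0`. [ours] -/
theorem crnPair_diag_offDiagonal [MeasurableEq Ω] (hw : Measurable w) (hw0 : ∀ y, 0 < w y)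
    (Khat : Kernel (Ω × Ω) (Ω × Ω))
    (hK : ∀ z : Ω × Ω, Khat z = (q.prod (volume : Measure unitInterval)).map (fun p : Ω × unitInterval =>
      ((if (p.2 : ℝ) * w z.1 ≤ w p.1 then p.1 else z.1), (if (p.2 : ℝ) * w z.2 ≤ w p.1 then p.1 else z.2))))
    (x : Ω) : Khat (x, x) (Set.diagonal Ω)ᶜ = 0 := by
  rw [crnPair_diag_apply hw hw0 Khat hK x]
  exact map_diag_offDiagonal _

/-- **NOR DOES THE RESIDUAL PAIR KERNEL SPLIT THEM**: `R̂((x, x), Δᶜ) = 0` (`w(x₀) > 1`; `R̂` the residual kernel of the pair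
minorisation `K̂ ≥ (1/w(x₀))·π̂`). [ours] -/
theorem residual_crnPair_diag_offDiagonal [MeasurableEq Ω] (hw : Measurable w) (hw0 : ∀ y, 0 < w y) {x₀ : Ω}
    (hmax : ∀ y, w y ≤ w x₀) [IsProbabilityMeasure (q.withDensity fun y => ENNReal.ofReal (w y))]
    (Khat : Kernel (Ω × Ω) (Ω × Ω)) [IsMarkovKernel Khat]
    (hK : ∀ z : Ω × Ω, Khat z = (q.prod (volume : Measure unitInterval)).map (fun p : Ω × unitInterval =>
      ((if (p.2 : ℝ) * w z.1 ≤ w p.1 then p.1 else z.1), (if (p.2 : ℝ) * w z.2 ≤ w p.1 then p.1 else z.2))))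
    (x : Ω) :
    (@Doeblin.residualKernel (Ω × Ω) _ Khat _ ((q.withDensity fun y => ENNReal.ofReal (w y)).map
        (fun y : Ω => (y, y))) (isProbabilityMeasure_diagLift _) (ENNReal.ofReal (w x₀)⁻¹)
        (crnPair_minorised hw hw0 hmax Khat hK)) (x, x) (Set.diagonal Ω)ᶜ = 0 := by
  haveI := isProbabilityMeasure_diagLift (q.withDensity fun y => ENNReal.ofReal (w y))
  rw [Doeblin.residualKernel_apply (x, x) measurableSet_diagonal.compl, crnPair_diag_offDiagonal hw hw0 Khat hK x,
    map_diag_offDiagonal, mul_zero, tsub_zero, mul_zero]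

/-- **`(μ̂R̂)(Δᶜ) ≤ μ̂(Δᶜ)` for every probability law `μ̂` on `Ω × Ω`**: the residual pair kernel cannot create disagreement from
agreement. [ours] -/
theorem bind_residual_crnPair_offDiagonal_le [MeasurableEq Ω] (hw : Measurable w) (hw0 : ∀ y, 0 < w y) {x₀ : Ω}
    (hmax : ∀ y, w y ≤ w x₀) (hlt : 1 < w x₀) [IsProbabilityMeasure (q.withDensity fun y => ENNReal.ofReal (w y))]
    (Khat : Kernel (Ω × Ω) (Ω × Ω)) [IsMarkovKernel Khat]
    (hK : ∀ z : Ω × Ω, Khat z = (q.prod (volume : Measure unitInterval)).map (fun p : Ω × unitInterval =>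
      ((if (p.2 : ℝ) * w z.1 ≤ w p.1 then p.1 else z.1), (if (p.2 : ℝ) * w z.2 ≤ w p.1 then p.1 else z.2))))
    (μ : Measure (Ω × Ω)) [IsProbabilityMeasure μ] :
    (μ.bind (@Doeblin.residualKernel (Ω × Ω) _ Khat _ ((q.withDensity fun y => ENNReal.ofReal (w y)).map
        (fun y : Ω => (y, y))) (isProbabilityMeasure_diagLift _) (ENNReal.ofReal (w x₀)⁻¹)
        (crnPair_minorised hw hw0 hmax Khat hK))) (Set.diagonal Ω)ᶜ ≤ μ (Set.diagonal Ω)ᶜ := by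
  haveI := isProbabilityMeasure_diagLift (q.withDensity fun y => ENNReal.ofReal (w y))
  haveI := @Doeblin.isMarkovKernel_residualKernel (Ω × Ω) _ Khat _ ((q.withDensity fun y => ENNReal.ofReal (w y)).map
    (fun y : Ω => (y, y))) (isProbabilityMeasure_diagLift _) (ENNReal.ofReal (w x₀)⁻¹)
    (crnPair_minorised hw hw0 hmax Khat hK) (ofReal_inv_lt_one_of_one_lt hlt)
  set R := @Doeblin.residualKernel (Ω × Ω) _ Khat _ ((q.withDensity fun y => ENNReal.ofReal (w y)).map
    (fun y : Ω => (y, y))) (isProbabilityMeasure_diagLift _) (ENNReal.ofReal (w x₀)⁻¹)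
    (crnPair_minorised hw hw0 hmax Khat hK) with hR
  have hD : MeasurableSet (Set.diagonal Ω) := measurableSet_diagonal
  rw [Measure.bind_apply hD.compl (Kernel.aemeasurable _), ← lintegral_add_compl _ hD]
  -- on the diagonal the integrand vanishes; off it, it is at most one
  have h1 : ∫⁻ z in Set.diagonal Ω, R z (Set.diagonal Ω)ᶜ ∂μ = 0 := by
    refine le_antisymm ?_ bot_le
    calc ∫⁻ z in Set.diagonal Ω, R z (Set.diagonal Ω)ᶜ ∂μ ≤ ∫⁻ _ in Set.diagonal Ω, 0 ∂μ :=
          setLIntegral_mono' hD fun z hz => by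
            obtain ⟨a, b⟩ := z
            have hab : a = b := hz
            subst hab
            rw [hR, residual_crnPair_diag_offDiagonal hw hw0 hmax Khat hK a]
      _ = 0 := by rw [lintegral_zero]
  have h2 : ∫⁻ z in (Set.diagonal Ω)ᶜ, R z (Set.diagonal Ω)ᶜ ∂μ ≤ μ (Set.diagonal Ω)ᶜ :=
    calc ∫⁻ z in (Set.diagonal Ω)ᶜ, R z (Set.diagonal Ω)ᶜ ∂μ ≤ ∫⁻ _ in (Set.diagonal Ω)ᶜ, 1 ∂μ :=
          lintegral_mono fun z => prob_le_one
      _ = μ (Set.diagonal Ω)ᶜ := by rw [setLIntegral_const, one_mul]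
  rw [h1, zero_add]
  exact h2

/-- **`(μ̂R̂ⁿ)(Δᶜ) ≤ μ̂(Δᶜ)`** for every `n`. [ours] -/
theorem iterate_bind_residual_crnPair_offDiagonal_le [MeasurableEq Ω] (hw : Measurable w) (hw0 : ∀ y, 0 < w y) {x₀ : Ω}
    (hmax : ∀ y, w y ≤ w x₀) (hlt : 1 < w x₀) [IsProbabilityMeasure (q.withDensity fun y => ENNReal.ofReal (w y))]
    (Khat : Kernel (Ω × Ω) (Ω × Ω)) [IsMarkovKernel Khat]
    (hK : ∀ z : Ω × Ω, Khat z = (q.prod (volume : Measure unitInterval)).map (fun p : Ω × unitInterval =>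
      ((if (p.2 : ℝ) * w z.1 ≤ w p.1 then p.1 else z.1), (if (p.2 : ℝ) * w z.2 ≤ w p.1 then p.1 else z.2)))) :
    ∀ (n : ℕ) (μ : Measure (Ω × Ω)) [IsProbabilityMeasure μ],
      ((fun m : Measure (Ω × Ω) => m.bind (@Doeblin.residualKernel (Ω × Ω) _ Khat _
          ((q.withDensity fun y => ENNReal.ofReal (w y)).map (fun y : Ω => (y, y))) (isProbabilityMeasure_diagLift _)
          (ENNReal.ofReal (w x₀)⁻¹) (crnPair_minorised hw hw0 hmax Khat hK)))^[n] μ) (Set.diagonal Ω)ᶜ ≤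
        μ (Set.diagonal Ω)ᶜ
  | 0, μ, _ => le_rfl
  | n + 1, μ, _ => by
    haveI := isProbabilityMeasure_diagLift (q.withDensity fun y => ENNReal.ofReal (w y))
    haveI := @Doeblin.isMarkovKernel_residualKernel (Ω × Ω) _ Khat _ ((q.withDensity fun y => ENNReal.ofReal (w y)).map
      (fun y : Ω => (y, y))) (isProbabilityMeasure_diagLift _) (ENNReal.ofReal (w x₀)⁻¹)
      (crnPair_minorised hw hw0 hmax Khat hK) (ofReal_inv_lt_one_of_one_lt hlt)
    haveI := isProbabilityMeasure_iterate_bind (κ := @Doeblin.residualKernel (Ω × Ω) _ Khat _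
      ((q.withDensity fun y => ENNReal.ofReal (w y)).map (fun y : Ω => (y, y))) (isProbabilityMeasure_diagLift _)
      (ENNReal.ofReal (w x₀)⁻¹) (crnPair_minorised hw hw0 hmax Khat hK)) μ n
    rw [Function.iterate_succ_apply']
    exact (bind_residual_crnPair_offDiagonal_le hw hw0 hmax hlt Khat hK _).trans
      (iterate_bind_residual_crnPair_offDiagonal_le hw hw0 hmax hlt Khat hK n μ)

/-! ## §2 The contraction of the disagreement probability -/

/-- **COMMON RANDOM NUMBERS CONTRACT THE DISAGREEMENT PROBABILITY.**  `w` measurable, positive, normalised, maximal at `x₀`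
(`r = 1 − 1/w(x₀)`); `K̂` a CRN pair kernel; `MeasurableEq Ω`.  For every initial coupling `μ̂₀` and every `n`:
`P(X_n ≠ X′_n) ≤ rⁿ·P(X_0 ≠ X′_0)`. [ours] -/
theorem iterate_bind_crnPair_offDiagonal_le [MeasurableEq Ω] (hw : Measurable w) (hw0 : ∀ y, 0 < w y) {x₀ : Ω}
    (hmax : ∀ y, w y ≤ w x₀) [IsProbabilityMeasure (q.withDensity fun y => ENNReal.ofReal (w y))]
    (Khat : Kernel (Ω × Ω) (Ω × Ω)) [IsMarkovKernel Khat]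
    (hK : ∀ z : Ω × Ω, Khat z = (q.prod (volume : Measure unitInterval)).map (fun p : Ω × unitInterval =>
      ((if (p.2 : ℝ) * w z.1 ≤ w p.1 then p.1 else z.1), (if (p.2 : ℝ) * w z.2 ≤ w p.1 then p.1 else z.2))))
    (n : ℕ) (μ₀ : Measure (Ω × Ω)) [IsProbabilityMeasure μ₀] :
    ((fun m : Measure (Ω × Ω) => m.bind Khat)^[n] μ₀).real (Set.diagonal Ω)ᶜ ≤
      (1 - (w x₀)⁻¹) ^ n * μ₀.real (Set.diagonal Ω)ᶜ := by
  have hW : 1 ≤ w x₀ := one_le_of_mode (q := q) hmax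
  have hr0 : 0 ≤ 1 - (w x₀)⁻¹ := sub_nonneg.2 (inv_le_one_of_one_le₀ hW)
  have hr1 : 1 - (w x₀)⁻¹ ≤ 1 := sub_le_self _ (inv_nonneg.mpr (hw0 x₀).le)
  have hD : MeasurableSet (Set.diagonal Ω) := measurableSet_diagonal
  rcases hW.lt_or_eq with hlt | h1
  · haveI := isProbabilityMeasure_diagLift (q.withDensity fun y => ENNReal.ofReal (w y))
    haveI := @Doeblin.isMarkovKernel_residualKernel (Ω × Ω) _ Khat _ ((q.withDensity fun y => ENNReal.ofReal (w y)).map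
      (fun y : Ω => (y, y))) (isProbabilityMeasure_diagLift _) (ENNReal.ofReal (w x₀)⁻¹)
      (crnPair_minorised hw hw0 hmax Khat hK) (ofReal_inv_lt_one_of_one_lt hlt)
    set R := @Doeblin.residualKernel (Ω × Ω) _ Khat _ ((q.withDensity fun y => ENNReal.ofReal (w y)).map
      (fun y : Ω => (y, y))) (isProbabilityMeasure_diagLift _) (ENNReal.ofReal (w x₀)⁻¹)
      (crnPair_minorised hw hw0 hmax Khat hK) with hR
    haveI := isProbabilityMeasure_iterate_bind (κ := R) μ₀ n
    have hsplit := iterate_bind_crnPair_eq_residual_mixture hw hw0 hmax hlt Khat hK n μ₀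
    have hres := iterate_bind_residual_crnPair_offDiagonal_le hw hw0 hmax hlt Khat hK n μ₀
    simp only [measureReal_def]
    rw [hsplit, Measure.add_apply, Measure.smul_apply, Measure.smul_apply, smul_eq_mul, smul_eq_mul, map_diag_offDiagonal,
      mul_zero, zero_add, ENNReal.toReal_mul, ENNReal.toReal_ofReal (pow_nonneg hr0 n)]
    exact mul_le_mul_of_nonneg_left (ENNReal.toReal_mono (measure_ne_top _ _) hres) (pow_nonneg hr0 n)
  · -- `w(x₀) = 1`: after one shared update the pair sits on the diagonal lift of `π`
    rcases n with _ | n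
    · simp
    · have hstep : ∀ (m : Measure (Ω × Ω)) [IsProbabilityMeasure m],
          m.bind Khat = (q.withDensity fun y => ENNReal.ofReal (w y)).map (fun y : Ω => (y, y)) := by
        intro m _
        ext C hC
        rw [Measure.bind_apply hC (Kernel.aemeasurable _)]
        simp_rw [crnPair_apply_eq_diagLift_of_mode_eq_one hw hw0 hmax h1.symm Khat hK]
        rw [lintegral_const, measure_univ, mul_one]
      haveI := isProbabilityMeasure_iterate_bind (κ := Khat) μ₀ n
      rw [Function.iterate_succ_apply', hstep, measureReal_def, map_diag_offDiagonal, ENNReal.toReal_zero]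
      exact mul_nonneg (pow_nonneg hr0 _) measureReal_nonneg

/-- **`P(X_n = X′_n) ≥ 1 − rⁿ·P(X_0 ≠ X′_0)`** from every initial coupling. [ours] -/
theorem iterate_bind_crnPair_diagonal_ge_init [MeasurableEq Ω] (hw : Measurable w) (hw0 : ∀ y, 0 < w y) {x₀ : Ω}
    (hmax : ∀ y, w y ≤ w x₀) [IsProbabilityMeasure (q.withDensity fun y => ENNReal.ofReal (w y))]
    (Khat : Kernel (Ω × Ω) (Ω × Ω)) [IsMarkovKernel Khat]
    (hK : ∀ z : Ω × Ω, Khat z = (q.prod (volume : Measure unitInterval)).map (fun p : Ω × unitInterval =>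
      ((if (p.2 : ℝ) * w z.1 ≤ w p.1 then p.1 else z.1), (if (p.2 : ℝ) * w z.2 ≤ w p.1 then p.1 else z.2))))
    (n : ℕ) (μ₀ : Measure (Ω × Ω)) [IsProbabilityMeasure μ₀] :
    1 - (1 - (w x₀)⁻¹) ^ n * μ₀.real (Set.diagonal Ω)ᶜ ≤
      ((fun m : Measure (Ω × Ω) => m.bind Khat)^[n] μ₀).real (Set.diagonal Ω) := by
  haveI := isProbabilityMeasure_iterate_bind (κ := Khat) μ₀ n
  have h := iterate_bind_crnPair_offDiagonal_le hw hw0 hmax Khat hK n μ₀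
  rw [measureReal_compl measurableSet_diagonal, probReal_univ] at h
  linarith

/-- **OBSERVABLES**: `E|g(X_n) − g(X′_n)| ≤ rⁿ·P(X_0 ≠ X′_0)·(c − a)` for measurable `a ≤ g ≤ c`, from every initial coupling
(one-time laws). [ours] -/
theorem integral_iterate_bind_crnPair_abs_sub_le_init [MeasurableEq Ω] (hw : Measurable w) (hw0 : ∀ y, 0 < w y) {x₀ : Ω}
    (hmax : ∀ y, w y ≤ w x₀) [IsProbabilityMeasure (q.withDensity fun y => ENNReal.ofReal (w y))]
    (Khat : Kernel (Ω × Ω) (Ω × Ω)) [IsMarkovKernel Khat]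
    (hK : ∀ z : Ω × Ω, Khat z = (q.prod (volume : Measure unitInterval)).map (fun p : Ω × unitInterval =>
      ((if (p.2 : ℝ) * w z.1 ≤ w p.1 then p.1 else z.1), (if (p.2 : ℝ) * w z.2 ≤ w p.1 then p.1 else z.2))))
    (n : ℕ) (μ₀ : Measure (Ω × Ω)) [IsProbabilityMeasure μ₀] {g : Ω → ℝ} (hg : Measurable g) {a c : ℝ}
    (ha : ∀ x, a ≤ g x) (hc : ∀ x, g x ≤ c) :
    ∫ z, |g z.1 - g z.2| ∂((fun m : Measure (Ω × Ω) => m.bind Khat)^[n] μ₀) ≤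
      (1 - (w x₀)⁻¹) ^ n * μ₀.real (Set.diagonal Ω)ᶜ * (c - a) := by
  haveI := isProbabilityMeasure_iterate_bind (κ := Khat) μ₀ n
  set P : Measure (Ω × Ω) := (fun m : Measure (Ω × Ω) => m.bind Khat)^[n] μ₀ with hP
  have hD : MeasurableSet (Set.diagonal Ω) := measurableSet_diagonal
  have hca : 0 ≤ c - a := by have := ha x₀; have := hc x₀; linarith
  -- `|g z.1 − g z.2| ≤ (c − a)·1_{Δᶜ}(z)`
  have hpt : ∀ z : Ω × Ω, |g z.1 - g z.2| ≤ (c - a) * (Set.diagonal Ω)ᶜ.indicator 1 z := by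
    intro z
    by_cases hz : z ∈ (Set.diagonal Ω)ᶜ
    · rw [Set.indicator_of_mem hz, Pi.one_apply, mul_one]
      have h1 := ha z.1; have h2 := hc z.1; have h3 := ha z.2; have h4 := hc z.2
      exact abs_le.2 ⟨by linarith, by linarith⟩
    · rw [Set.indicator_of_notMem hz, mul_zero]
      have hz' : z.1 = z.2 := by
        rw [Set.mem_compl_iff, not_not, Set.mem_diagonal_iff] at hz; exact hz
      rw [hz', sub_self, abs_zero]
  have hgi : Integrable (fun z : Ω × Ω => |g z.1 - g z.2|) P :=
    integrable_of_bounded P ((hg.comp measurable_fst).sub (hg.comp measurable_snd)).abs (C := c - a) (fun z => by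
      rw [abs_abs]
      have h1 := ha z.1; have h2 := hc z.1; have h3 := ha z.2; have h4 := hc z.2
      exact abs_le.2 ⟨by linarith, by linarith⟩)
  have hii : Integrable (fun z : Ω × Ω => (c - a) * (Set.diagonal Ω)ᶜ.indicator 1 z) P :=
    ((integrable_const (1 : ℝ)).indicator hD.compl).const_mul _
  calc ∫ z, |g z.1 - g z.2| ∂P ≤ ∫ z, (c - a) * (Set.diagonal Ω)ᶜ.indicator 1 z ∂P := integral_mono hgi hii hpt
    _ = (c - a) * P.real (Set.diagonal Ω)ᶜ := by
        rw [integral_const_mul, integral_indicator_one hD.compl]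
    _ ≤ (c - a) * ((1 - (w x₀)⁻¹) ^ n * μ₀.real (Set.diagonal Ω)ᶜ) :=
        mul_le_mul_of_nonneg_left (iterate_bind_crnPair_offDiagonal_le hw hw0 hmax Khat hK n μ₀) hca
    _ = _ := by ring

/-- **ON THE PAIR PATH LAW**: `E|g(X_n) − g(X′_n)| ≤ rⁿ·P(X_0 ≠ X′_0)·(c − a)` for the coupled simulation started from `μ̂₀`
(`w` measurable as a `Fact`, for the path-law bookkeeping of `IMHColdStartPathAverage`). [ours] -/
theorem crn_chain_integral_abs_sub_le_init [MeasurableEq Ω] [Fact (Measurable w)] (hw0 : ∀ y, 0 < w y) {x₀ : Ω}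
    (hmax : ∀ y, w y ≤ w x₀) [IsProbabilityMeasure (q.withDensity fun y => ENNReal.ofReal (w y))]
    (Khat : Kernel (Ω × Ω) (Ω × Ω)) [IsMarkovKernel Khat]
    (hK : ∀ z : Ω × Ω, Khat z = (q.prod (volume : Measure unitInterval)).map (fun p : Ω × unitInterval =>
      ((if (p.2 : ℝ) * w z.1 ≤ w p.1 then p.1 else z.1), (if (p.2 : ℝ) * w z.2 ≤ w p.1 then p.1 else z.2))))
    (μ₀ : Measure (Ω × Ω)) [IsProbabilityMeasure μ₀] {g : Ω → ℝ} (hg : Measurable g) {a c : ℝ}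
    (ha : ∀ x, a ≤ g x) (hc : ∀ x, g x ≤ c) (n : ℕ) :
    ∫ z, |g ((z n).1) - g ((z n).2)| ∂(Kernel.trajMeasure (X := fun _ : ℕ => Ω × Ω) μ₀
        (fun n : ℕ => Khat.comap (fun h : (i : ↥(Finset.Iic n)) → Ω × Ω => h ⟨n, Finset.mem_Iic.2 le_rfl⟩)
          (measurable_pi_apply _))) ≤ (1 - (w x₀)⁻¹) ^ n * μ₀.real (Set.diagonal Ω)ᶜ * (c - a) := by
  have hb : ∀ p : Ω × Ω, |(fun p : Ω × Ω => |g p.1 - g p.2|) p| ≤ c - a := by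
    intro p
    dsimp only
    rw [abs_abs]
    have h1 := ha p.1; have h2 := hc p.1; have h3 := ha p.2; have h4 := hc p.2
    exact abs_le.2 ⟨by linarith, by linarith⟩
  rw [chain_expect_eq_integral_iterate_bind Khat μ₀ (f := fun p : Ω × Ω => |g p.1 - g p.2|)
      ((hg.comp measurable_fst).sub (hg.comp measurable_snd)).abs hb n]
  exact integral_iterate_bind_crnPair_abs_sub_le_init Fact.out hw0 hmax Khat hK n μ₀ hg ha hc

end Summit.Ventures.LatticeQCDFlow.Exactness

end
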